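import Summits.NavierStokesRegularity.NavierStokesRegularity.Theorems.ExtremiserTransienceKStarAttainedContact
import HarnessLib

/-!
# Route `ExtremiserTransience`, support item `KStarAttained` (stmt-NavierStokesRegularity-24370):
# THE EULER–LAGRANGE SYSTEM OF AN ATTAINER OF `κ⋆` IN STRONG FORM, OFF THE CONTACT SET

`--supports stmt-NavierStokesRegularity-24370`. Author: prover seat `ns-et-p1` (g3).

`…KStarAttainedDensity.exists_density` hides the density `G` of the first-variation functional on curls behind
an existential. This file writes it out and derives the pointwise (strong) Euler–Lagrange system of a smooth
attainer on the open non-contact set `{x : ‖v x‖ < M}`. With `ω = curl v`, `s₁ = Dv ω` (`= (ω·∇)v`),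
`s₂ = Dω ω` (`= (ω·∇)ω`), `s₃ = Dvᵀω = Σⱼ ⟪ω, ∂ⱼv⟫ eⱼ`, `J = ∫⟪ω, Dv ω⟫`, `Z = ‖ω‖₂²`, `W = ‖∇ω‖₂²`:

* `KStar.density_formula` — for every `η ∈ C^∞_c` and reals `c_J, c_a, c_c`,
  `c_J·J₁(curl η) + c_a·a₁(curl η) + c_c·c₁(curl η) = ∫⟪G, η⟫` with
  `G = c_J·(curl curl s₁ − curl s₂ + curl curl s₃) + c_a·curl curl ω − c_c·curl curl Δω`;
* `KStar.eulerLagrange_offContact` — **if `(v, M, B)` is admissible, `‖v‖ ≤ M`, and attains `κ⋆`, then at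
  every point `x` with `‖v x‖ < M`:**
  `J·(curl curl s₁ − curl s₂ + curl curl s₃)(x) = κ⋆²M²·(W·curl curl ω − Z·curl curl Δω)(x)`,
  i.e. `curl g = 0` off the contact set for the smooth Euler–Lagrange field
  `g = J(curl s₁ − s₂ + curl s₃) + κ⋆²M²(W Δv − Z Δ²v)` — a fourth-order (bi-Laplacian, Stokes-type modulo
  gradients) semilinear elliptic system. (Since `div ω = 0`, `curl curl ω = −Δω`, `curl curl Δω = −Δ²ω`.)

Together with `…KStarAttainedContact` (plateau `{‖v‖ = M}` with nonempty interior) and `…KStarAttainedMultiplier`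
(nonnegative multiplier on the contact set) this is the complete first-order (KKT) description of a putative
extremiser; what is NOT decided is whether such a `C^∞`, `L²` object exists (the item). Nothing about
Navier–Stokes solutions; NS regularity is NOT proved by anything here. [folklore]
-/

noncomputable section

open Set Filter Topology MeasureTheory Metric
open scoped InnerProductSpace RealInnerProductSpace ENNReal NNReal ContDiff Laplacian
open Literature.Analysis.FluidPDE

namespace Summit.NavierStokesRegularity.NavierStokesRegularity.Theorems

-- the problem directory repeats the summit name (`NavierStokesRegularity/NavierStokesRegularity`)
set_option linter.dupNamespace false

namespace DepletionLadder.KStar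

variable {v : EuclideanSpace ℝ (Fin 3) → EuclideanSpace ℝ (Fin 3)}

/-- The explicit density is continuous (for `v ∈ C^∞`). [folklore] -/
theorem continuous_density (hv : ContDiff ℝ ∞ v) (cJ ca cc : ℝ) :
    Continuous fun x => (cJ • (curl (curl (fun y => fderiv ℝ v y (curl v y))) x - curl (fun y => fderiv ℝ (curl v) y (curl v y)) x +
        curl (curl (fun y => ∑ j, ⟪curl v y, fderiv ℝ v y (EuclideanSpace.basisFun (Fin 3) ℝ j)⟫ •
        EuclideanSpace.basisFun (Fin 3) ℝ j)) x) +
      ca • curl (curl (curl v)) x - cc • curl (curl (Δ (curl v))) x) := by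
  have hω : ContDiff ℝ ∞ (curl v) := contDiff_curl_top hv
  have c₁ : ContDiff ℝ ∞ (fun y => fderiv ℝ v y (curl v y)) := (hv.fderiv_right (m := ∞) le_rfl).clm_apply hω
  have c₂ : ContDiff ℝ ∞ (fun y => fderiv ℝ (curl v) y (curl v y)) := (hω.fderiv_right (m := ∞) le_rfl).clm_apply hω
  have c₃ : ContDiff ℝ ∞ (fun y => ∑ j, ⟪curl v y, fderiv ℝ v y (EuclideanSpace.basisFun (Fin 3) ℝ j)⟫ •
        EuclideanSpace.basisFun (Fin 3) ℝ j) :=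
    ContDiff.sum fun j _ => (hω.inner ℝ ((hv.fderiv_right (m := ∞) le_rfl).clm_apply contDiff_const)).smul
      contDiff_const
  have hΔ : ContDiff ℝ 2 (Δ (curl v)) := contDiff_laplacian (n := 2) (hω.of_le (by norm_cast))
  have k₁ := (contDiff_curl_top (contDiff_curl_top c₁)).continuous
  have k₂ := (contDiff_curl_top c₂).continuous
  have k₃ := (contDiff_curl_top (contDiff_curl_top c₃)).continuous
  have k₄ := (contDiff_curl_top (contDiff_curl_top hω)).continuous
  have k₅ : Continuous (curl (curl (Δ (curl v)))) := continuous_curl (contDiff_curl (n := 1) (by exact_mod_cast hΔ))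
  exact (((k₁.sub k₂).add k₃).const_smul cJ |>.add (k₄.const_smul ca)).sub (k₅.const_smul cc)

/-- **The density formula.** For `v ∈ C^∞`, reals `c_J, c_a, c_c` and `η ∈ C^∞_c`:
`c_J·J₁(curl η) + c_a·a₁(curl η) + c_c·c₁(curl η) = ∫⟪G, η⟫` with the explicit `G` of the module docstring
(`integral_T1/T2/T3/A1/C1` of `…KStarAttainedDensity`). [folklore] -/
theorem density_formula (hv : ContDiff ℝ ∞ v) (cJ ca cc : ℝ)
    {η : EuclideanSpace ℝ (Fin 3) → EuclideanSpace ℝ (Fin 3)} (hη : ContDiff ℝ ∞ η) (hηc : HasCompactSupport η) :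
    cJ * (∫ x, (⟪curl (curl η) x, fderiv ℝ v x (curl v x)⟫ + ⟪curl v x, fderiv ℝ (curl η) x (curl v x)⟫ +
          ⟪curl v x, fderiv ℝ v x (curl (curl η) x)⟫)) + ca * (∫ x, ⟪curl v x, curl (curl η) x⟫) + cc * (∫ x, ∑ i, ⟪fderiv ℝ (curl v) x (EuclideanSpace.basisFun (Fin 3) ℝ i),
          fderiv ℝ (curl (curl η)) x (EuclideanSpace.basisFun (Fin 3) ℝ i)⟫) =
      ∫ x, ⟪(cJ • (curl (curl (fun y => fderiv ℝ v y (curl v y))) x - curl (fun y => fderiv ℝ (curl v) y (curl v y)) x +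
        curl (curl (fun y => ∑ j, ⟪curl v y, fderiv ℝ v y (EuclideanSpace.basisFun (Fin 3) ℝ j)⟫ •
        EuclideanSpace.basisFun (Fin 3) ℝ j)) x) +
      ca • curl (curl (curl v)) x - cc • curl (curl (Δ (curl v))) x), η x⟫ := by
  have hω : ContDiff ℝ ∞ (curl v) := contDiff_curl_top hv
  have c₁ : ContDiff ℝ ∞ (fun y => fderiv ℝ v y (curl v y)) := (hv.fderiv_right (m := ∞) le_rfl).clm_apply hω
  have c₂ : ContDiff ℝ ∞ (fun y => fderiv ℝ (curl v) y (curl v y)) := (hω.fderiv_right (m := ∞) le_rfl).clm_apply hω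
  have c₃ : ContDiff ℝ ∞ (fun y => ∑ j, ⟪curl v y, fderiv ℝ v y (EuclideanSpace.basisFun (Fin 3) ℝ j)⟫ •
        EuclideanSpace.basisFun (Fin 3) ℝ j) :=
    ContDiff.sum fun j _ => (hω.inner ℝ ((hv.fderiv_right (m := ∞) le_rfl).clm_apply contDiff_const)).smul
      contDiff_const
  have hΔ : ContDiff ℝ 2 (Δ (curl v)) := contDiff_laplacian (n := 2) (hω.of_le (by norm_cast))
  have hcη : ContDiff ℝ ∞ (curl η) := contDiff_curl_top hη
  have hcηc : HasCompactSupport (curl η) := hasCompactSupport_curl hηc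
  have cω := hω.continuous
  have cDv : Continuous (fderiv ℝ v) := hv.continuous_fderiv (by simp)
  have cDψ : Continuous (fderiv ℝ (curl η)) := hcη.continuous_fderiv (by simp)
  have iT1 : Integrable (fun x => ⟪curl (curl η) x, fderiv ℝ v x (curl v x)⟫)
      (volume : Measure (EuclideanSpace ℝ (Fin 3))) :=
    integrable_of_vanish (φ := curl η) hcηc ((continuous_curl (hcη.of_le (by norm_cast))).inner
      (cDv.clm_apply cω)) fun x hx => by simp [(vanish_of_notMem_tsupport (φ := curl η) hx).2.1]
  have iT2 : Integrable (fun x => ⟪curl v x, fderiv ℝ (curl η) x (curl v x)⟫)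
      (volume : Measure (EuclideanSpace ℝ (Fin 3))) :=
    integrable_of_vanish (φ := curl η) hcηc (cω.inner (cDψ.clm_apply cω)) fun x hx => by
      simp [(vanish_of_notMem_tsupport (φ := curl η) hx).2.2.1]
  have iT3 : Integrable (fun x => ⟪curl v x, fderiv ℝ v x (curl (curl η) x)⟫)
      (volume : Measure (EuclideanSpace ℝ (Fin 3))) :=
    integrable_of_vanish (φ := curl η) hcηc (cω.inner (cDv.clm_apply
      (continuous_curl (hcη.of_le (by norm_cast))))) fun x hx => by
      simp [(vanish_of_notMem_tsupport (φ := curl η) hx).2.1]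
  have hJ1 : (∫ x, (⟪curl (curl η) x, fderiv ℝ v x (curl v x)⟫ + ⟪curl v x, fderiv ℝ (curl η) x (curl v x)⟫ +
          ⟪curl v x, fderiv ℝ v x (curl (curl η) x)⟫)) =
      (∫ x, ⟪curl (curl (fun y => fderiv ℝ v y (curl v y))) x, η x⟫) - (∫ x, ⟪curl (fun y => fderiv ℝ (curl v) y (curl v y)) x, η x⟫) +
        ∫ x, ⟪curl (curl (fun y => ∑ j, ⟪curl v y, fderiv ℝ v y (EuclideanSpace.basisFun (Fin 3) ℝ j)⟫ •
        EuclideanSpace.basisFun (Fin 3) ℝ j)) x, η x⟫ := by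
    rw [integral_add ?_ iT3, integral_add iT1 iT2, integral_T1 hv hη hηc, integral_T2 hv hη hηc,
      integral_T3 hv hη hηc]
    · ring
    · exact iT1.add iT2
  rw [hJ1, integral_A1 hv hη hηc, integral_C1 hv hη hηc]
  have iG : ∀ {F : EuclideanSpace ℝ (Fin 3) → EuclideanSpace ℝ (Fin 3)}, Continuous F →
      Integrable (fun x => ⟪F x, η x⟫) (volume : Measure (EuclideanSpace ℝ (Fin 3))) := fun hF =>
    integrable_inner_of_hasCompactSupport_right hF hη.continuous hηc
  have k₁ := (contDiff_curl_top (contDiff_curl_top c₁)).continuous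
  have k₂ := (contDiff_curl_top c₂).continuous
  have k₃ := (contDiff_curl_top (contDiff_curl_top c₃)).continuous
  have k₄ := (contDiff_curl_top (contDiff_curl_top hω)).continuous
  have k₅ : Continuous (curl (curl (Δ (curl v)))) := continuous_curl (contDiff_curl (n := 1) (by exact_mod_cast hΔ))
  have hpt : ∀ x, ⟪(cJ • (curl (curl (fun y => fderiv ℝ v y (curl v y))) x - curl (fun y => fderiv ℝ (curl v) y (curl v y)) x +
        curl (curl (fun y => ∑ j, ⟪curl v y, fderiv ℝ v y (EuclideanSpace.basisFun (Fin 3) ℝ j)⟫ •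
        EuclideanSpace.basisFun (Fin 3) ℝ j)) x) +
      ca • curl (curl (curl v)) x - cc • curl (curl (Δ (curl v))) x), η x⟫ =
      cJ * (⟪curl (curl (fun y => fderiv ℝ v y (curl v y))) x, η x⟫ - ⟪curl (fun y => fderiv ℝ (curl v) y (curl v y)) x, η x⟫ + ⟪curl (curl (fun y => ∑ j, ⟪curl v y, fderiv ℝ v y (EuclideanSpace.basisFun (Fin 3) ℝ j)⟫ •
        EuclideanSpace.basisFun (Fin 3) ℝ j)) x, η x⟫) +
      ca * ⟪curl (curl (curl v)) x, η x⟫ - cc * ⟪curl (curl (Δ (curl v))) x, η x⟫ := fun x => by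
    simp only [inner_sub_left, inner_add_left, inner_smul_left, RCLike.conj_to_real]
  rw [integral_congr_ae (Eventually.of_forall hpt), integral_sub ?_ ?_, integral_add ?_ ?_,
    integral_const_mul, integral_const_mul, integral_const_mul, integral_add ?_ ?_, integral_sub ?_ ?_]
  · ring
  all_goals first
    | exact iG k₁ | exact iG k₂ | exact iG k₃ | exact iG k₄ | exact iG k₅
    | exact (iG k₁).sub (iG k₂) | exact ((iG k₁).sub (iG k₂)).add (iG k₃)
    | exact (((iG k₁).sub (iG k₂)).add (iG k₃)).const_mul cJ | exact (iG k₄).const_mul ca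
    | exact (iG k₅).const_mul cc
    | exact ((((iG k₁).sub (iG k₂)).add (iG k₃)).const_mul cJ).add ((iG k₄).const_mul ca)

/-- **THE STRONG EULER–LAGRANGE SYSTEM OFF THE CONTACT SET.** Let `(v, M, B)` be admissible with `‖v‖ ≤ M`
and attain `κ⋆` (`|J| = κ⋆·M·‖ω‖₂·‖∇ω‖₂`). Then at every point `x` of the open set `{‖v‖ < M}`:
`J·(curl curl s₁ − curl s₂ + curl curl s₃)(x) − κ⋆²M²W·(curl curl ω)(x) + κ⋆²M²Z·(curl curl Δω)(x) = 0`
(weak form `firstVariation_eq_zero_offContact` + `density_formula` + du Bois-Reymond on the open set +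
continuity). [folklore] -/
theorem eulerLagrange_offContact (hv : ContDiff ℝ ∞ v) (hdiv : VectorCalculus.IsDivFree v) {M B : ℝ}
    (hM : ∀ x, ‖v x‖ ≤ M) (hB : ∀ x, ‖fderiv ℝ v x‖ ≤ B) (h0 : ∫⁻ x, ‖iteratedFDeriv ℝ 0 v x‖ₑ ^ 2 < ⊤)
    (h1 : ∫⁻ x, ‖iteratedFDeriv ℝ 1 v x‖ₑ ^ 2 < ⊤) (h2 : ∫⁻ x, ‖iteratedFDeriv ℝ 2 v x‖ₑ ^ 2 < ⊤)
    (hatt : |∫ x, ⟪curl v x, fderiv ℝ v x (curl v x)⟫| =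
      sInf {κ : ℝ | (∀ (v : EuclideanSpace ℝ (Fin 3) → EuclideanSpace ℝ (Fin 3)) (M B : ℝ), ContDiff ℝ (⊤ : ℕ∞) v → Literature.Analysis.FluidPDE.VectorCalculus.IsDivFree v → (∀ x, ‖v x‖ ≤ M) → (∀ x, ‖fderiv ℝ v x‖ ≤ B) → (∫⁻ x, ‖iteratedFDeriv ℝ 0 v x‖ₑ ^ 2 < ⊤) → (∫⁻ x, ‖iteratedFDeriv ℝ 1 v x‖ₑ ^ 2 < ⊤) → (∫⁻ x, ‖iteratedFDeriv ℝ 2 v x‖ₑ ^ 2 < ⊤) → |∫ x, ⟪Literature.Analysis.FluidPDE.curl v x, fderiv ℝ v x (Literature.Analysis.FluidPDE.curl v x)⟫_ℝ| ≤ κ * M * Real.sqrt (∫ x, ‖Literature.Analysis.FluidPDE.curl v x‖ ^ 2) * Real.sqrt (∫ x, Literature.Analysis.FluidPDE.frobeniusNormSq (fderiv ℝ (Literature.Analysis.FluidPDE.curl v) x)))} * M * Real.sqrt (∫ x, ‖curl v x‖ ^ 2) *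
        Real.sqrt (∫ x, frobeniusNormSq (fderiv ℝ (curl v) x)))
    {x : EuclideanSpace ℝ (Fin 3)} (hx : ‖v x‖ < M) :
    ((∫ x, ⟪curl v x, fderiv ℝ v x (curl v x)⟫) • (curl (curl (fun y => fderiv ℝ v y (curl v y))) x - curl (fun y => fderiv ℝ (curl v) y (curl v y)) x +
        curl (curl (fun y => ∑ j, ⟪curl v y, fderiv ℝ v y (EuclideanSpace.basisFun (Fin 3) ℝ j)⟫ •
        EuclideanSpace.basisFun (Fin 3) ℝ j)) x) +
      (-(sInf {κ : ℝ | (∀ (v : EuclideanSpace ℝ (Fin 3) → EuclideanSpace ℝ (Fin 3)) (M B : ℝ), ContDiff ℝ (⊤ : ℕ∞) v → Literature.Analysis.FluidPDE.VectorCalculus.IsDivFree v → (∀ x, ‖v x‖ ≤ M) → (∀ x, ‖fderiv ℝ v x‖ ≤ B) → (∫⁻ x, ‖iteratedFDeriv ℝ 0 v x‖ₑ ^ 2 < ⊤) → (∫⁻ x, ‖iteratedFDeriv ℝ 1 v x‖ₑ ^ 2 < ⊤) → (∫⁻ x, ‖iteratedFDeriv ℝ 2 v x‖ₑ ^ 2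 < ⊤) → |∫ x, ⟪Literature.Analysis.FluidPDE.curl v x, fderiv ℝ v x (Literature.Analysis.FluidPDE.curl v x)⟫_ℝ| ≤ κ * M * Real.sqrt (∫ x, ‖Literature.Analysis.FluidPDE.curl v x‖ ^ 2) * Real.sqrt (∫ x, Literature.Analysis.FluidPDE.frobeniusNormSq (fderiv ℝ (Literature.Analysis.FluidPDE.curl v) x)))} ^ 2 * M ^ 2 * (∫ x, frobeniusNormSq (fderiv ℝ (curl v) x)))) • curl (curl (curl v)) x - (-(sInf {κ : ℝ | (∀ (v : EuclideanSpace ℝ (Fin 3) → EuclideanSpace ℝ (Fin 3)) (M B : ℝ), ContDiff ℝ (⊤ : ℕ∞) v → Literature.Analysis.FluidPDE.VectorCalculus.IsDivFree v → (∀ x, ‖v x‖ ≤ M) → (∀ x, ‖fderiv ℝ v x‖ ≤ B) → (∫⁻ x, ‖iteratedFDeriv ℝ 0 v x‖ₑ ^ 2 < ⊤) → (∫⁻ x, ‖iteratedFDeriv ℝ 1 v x‖ₑ ^ 2 < ⊤) → (∫⁻ x, ‖iteratedFDeriv ℝ 2 v x‖ₑ ^ 2 < ⊤) → |∫ x, ⟪Literature.Analysis.FluidPDE.curl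 v x, fderiv ℝ v x (Literature.Analysis.FluidPDE.curl v x)⟫_ℝ| ≤ κ * M * Real.sqrt (∫ x, ‖Literature.Analysis.FluidPDE.curl v x‖ ^ 2) * Real.sqrt (∫ x, Literature.Analysis.FluidPDE.frobeniusNormSq (fderiv ℝ (Literature.Analysis.FluidPDE.curl v) x)))} ^ 2 * M ^ 2 * (∫ x, ‖curl v x‖ ^ 2))) • curl (curl (Δ (curl v))) x) = 0 := by
  have hUo : IsOpen {y | ‖v y‖ < M} := isOpen_lt (continuous_norm.comp hv.continuous) continuous_const
  have hGc := continuous_density hv (∫ x, ⟪curl v x, fderiv ℝ v x (curl v x)⟫) (-(sInf {κ : ℝ | (∀ (v : EuclideanSpace ℝ (Fin 3) → EuclideanSpace ℝ (Fin 3)) (M B : ℝ), ContDiff ℝ (⊤ : ℕ∞) v → Literature.Analysis.FluidPDE.VectorCalculus.IsDivFree v → (∀ x, ‖v x‖ ≤ M) → (∀ x, ‖fderiv ℝ v x‖ ≤ B) → (∫⁻ x, ‖iteratedFDeriv ℝ 0 v x‖ₑ ^ 2 < ⊤) → (∫⁻ x, ‖iteratedFDeriv ℝ 1 v x‖ₑ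 ^ 2 < ⊤) → (∫⁻ x, ‖iteratedFDeriv ℝ 2 v x‖ₑ ^ 2 < ⊤) → |∫ x, ⟪Literature.Analysis.FluidPDE.curl v x, fderiv ℝ v x (Literature.Analysis.FluidPDE.curl v x)⟫_ℝ| ≤ κ * M * Real.sqrt (∫ x, ‖Literature.Analysis.FluidPDE.curl v x‖ ^ 2) * Real.sqrt (∫ x, Literature.Analysis.FluidPDE.frobeniusNormSq (fderiv ℝ (Literature.Analysis.FluidPDE.curl v) x)))} ^ 2 * M ^ 2 * (∫ x, frobeniusNormSq (fderiv ℝ (curl v) x)))) (-(sInf {κ : ℝ | (∀ (v : EuclideanSpace ℝ (Fin 3) → EuclideanSpace ℝ (Fin 3)) (M B : ℝ), ContDiff ℝ (⊤ : ℕ∞) v → Literature.Analysis.FluidPDE.VectorCalculus.IsDivFree v → (∀ x, ‖v x‖ ≤ M) → (∀ x, ‖fderiv ℝ v x‖ ≤ B) → (∫⁻ x, ‖iteratedFDeriv ℝ 0 v x‖ₑ ^ 2 < ⊤) → (∫⁻ x, ‖iteratedFDeriv ℝ 1 v x‖ₑ ^ 2 < ⊤) → (∫⁻ x, ‖iteratedFDeriv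 ℝ 2 v x‖ₑ ^ 2 < ⊤) → |∫ x, ⟪Literature.Analysis.FluidPDE.curl v x, fderiv ℝ v x (Literature.Analysis.FluidPDE.curl v x)⟫_ℝ| ≤ κ * M * Real.sqrt (∫ x, ‖Literature.Analysis.FluidPDE.curl v x‖ ^ 2) * Real.sqrt (∫ x, Literature.Analysis.FluidPDE.frobeniusNormSq (fderiv ℝ (Literature.Analysis.FluidPDE.curl v) x)))} ^ 2 * M ^ 2 * (∫ x, ‖curl v x‖ ^ 2)))
  -- the weak Euler–Lagrange equation through the density
  have hℓ0 : ∀ η : EuclideanSpace ℝ (Fin 3) → EuclideanSpace ℝ (Fin 3), ContDiff ℝ ∞ η → HasCompactSupport η →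
      tsupport η ⊆ {y | ‖v y‖ < M} →
      ∫ y, ⟪((∫ x, ⟪curl v x, fderiv ℝ v x (curl v x)⟫) • (curl (curl (fun y => fderiv ℝ v y (curl v y))) y - curl (fun y => fderiv ℝ (curl v) y (curl v y)) y +
        curl (curl (fun y => ∑ j, ⟪curl v y, fderiv ℝ v y (EuclideanSpace.basisFun (Fin 3) ℝ j)⟫ •
        EuclideanSpace.basisFun (Fin 3) ℝ j)) y) +
      (-(sInf {κ : ℝ | (∀ (v : EuclideanSpace ℝ (Fin 3) → EuclideanSpace ℝ (Fin 3)) (M B : ℝ), ContDiff ℝ (⊤ : ℕ∞) v → Literature.Analysis.FluidPDE.VectorCalculus.IsDivFree v → (∀ x, ‖v x‖ ≤ M) → (∀ x, ‖fderiv ℝ v x‖ ≤ B) → (∫⁻ x, ‖iteratedFDeriv ℝ 0 v x‖ₑ ^ 2 < ⊤) → (∫⁻ x, ‖iteratedFDeriv ℝ 1 v x‖ₑ ^ 2 < ⊤) → (∫⁻ x, ‖iteratedFDeriv ℝ 2 v x‖ₑ ^ 2 < ⊤) → |∫ x, ⟪Literature.Analysis.FluidPDE.curl v x, fderiv ℝ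 v x (Literature.Analysis.FluidPDE.curl v x)⟫_ℝ| ≤ κ * M * Real.sqrt (∫ x, ‖Literature.Analysis.FluidPDE.curl v x‖ ^ 2) * Real.sqrt (∫ x, Literature.Analysis.FluidPDE.frobeniusNormSq (fderiv ℝ (Literature.Analysis.FluidPDE.curl v) x)))} ^ 2 * M ^ 2 * (∫ x, frobeniusNormSq (fderiv ℝ (curl v) x)))) • curl (curl (curl v)) y - (-(sInf {κ : ℝ | (∀ (v : EuclideanSpace ℝ (Fin 3) → EuclideanSpace ℝ (Fin 3)) (M B : ℝ), ContDiff ℝ (⊤ : ℕ∞) v → Literature.Analysis.FluidPDE.VectorCalculus.IsDivFree v → (∀ x, ‖v x‖ ≤ M) → (∀ x, ‖fderiv ℝ v x‖ ≤ B) → (∫⁻ x, ‖iteratedFDeriv ℝ 0 v x‖ₑ ^ 2 < ⊤) → (∫⁻ x, ‖iteratedFDeriv ℝ 1 v x‖ₑ ^ 2 < ⊤) → (∫⁻ x, ‖iteratedFDeriv ℝ 2 v x‖ₑ ^ 2 < ⊤) → |∫ x, ⟪Literature.Analysis.FluidPDE.curl v x, fderiv ℝ v x (Literature.Analysis.FluidPDE.curl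 v x)⟫_ℝ| ≤ κ * M * Real.sqrt (∫ x, ‖Literature.Analysis.FluidPDE.curl v x‖ ^ 2) * Real.sqrt (∫ x, Literature.Analysis.FluidPDE.frobeniusNormSq (fderiv ℝ (Literature.Analysis.FluidPDE.curl v) x)))} ^ 2 * M ^ 2 * (∫ x, ‖curl v x‖ ^ 2))) • curl (curl (Δ (curl v))) y), η y⟫ = 0 := by
    intro η hη hηc hηU
    have hcη : ContDiff ℝ ∞ (curl η) := contDiff_curl_top hη
    have h := firstVariation_eq_zero_offContact (φ := curl η) hv hdiv hM hB h0 h1 h2 hatt hcη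
      (hasCompactSupport_curl hηc) (fun y => divergence_curl_eq_zero_holds η (hη.of_le (by norm_cast)) y)
      ((tsupport_curl_subset η).trans hηU)
    have hd := density_formula hv (∫ x, ⟪curl v x, fderiv ℝ v x (curl v x)⟫) (-(sInf {κ : ℝ | (∀ (v : EuclideanSpace ℝ (Fin 3) → EuclideanSpace ℝ (Fin 3)) (M B : ℝ), ContDiff ℝ (⊤ : ℕ∞) v → Literature.Analysis.FluidPDE.VectorCalculus.IsDivFree v → (∀ x, ‖v x‖ ≤ M) → (∀ x, ‖fderiv ℝ v x‖ ≤ B) → (∫⁻ x, ‖iteratedFDeriv ℝ 0 v x‖ₑ ^ 2 < ⊤) → (∫⁻ x, ‖iteratedFDeriv ℝ 1 v x‖ₑ ^ 2 < ⊤) → (∫⁻ x, ‖iteratedFDeriv ℝ 2 v x‖ₑ ^ 2 < ⊤) → |∫ x, ⟪Literature.Analysis.FluidPDE.curl v x, fderiv ℝ v x (Literature.Analysis.FluidPDE.curl v x)⟫_ℝ| ≤ κ * M * Real.sqrt (∫ x, ‖Literature.Analysis.FluidPDE.curl v x‖ ^ 2) * Real.sqrt (∫ x, Literature.Analysis.FluidPDE.frobeniusNormSq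 (fderiv ℝ (Literature.Analysis.FluidPDE.curl v) x)))} ^ 2 * M ^ 2 * (∫ x, frobeniusNormSq (fderiv ℝ (curl v) x)))) (-(sInf {κ : ℝ | (∀ (v : EuclideanSpace ℝ (Fin 3) → EuclideanSpace ℝ (Fin 3)) (M B : ℝ), ContDiff ℝ (⊤ : ℕ∞) v → Literature.Analysis.FluidPDE.VectorCalculus.IsDivFree v → (∀ x, ‖v x‖ ≤ M) → (∀ x, ‖fderiv ℝ v x‖ ≤ B) → (∫⁻ x, ‖iteratedFDeriv ℝ 0 v x‖ₑ ^ 2 < ⊤) → (∫⁻ x, ‖iteratedFDeriv ℝ 1 v x‖ₑ ^ 2 < ⊤) → (∫⁻ x, ‖iteratedFDeriv ℝ 2 v x‖ₑ ^ 2 < ⊤) → |∫ x, ⟪Literature.Analysis.FluidPDE.curl v x, fderiv ℝ v x (Literature.Analysis.FluidPDE.curl v x)⟫_ℝ| ≤ κ * M * Real.sqrt (∫ x, ‖Literature.Analysis.FluidPDE.curl v x‖ ^ 2) * Real.sqrt (∫ x, Literature.Analysis.FluidPDE.frobeniusNormSq (fderiv ℝ (Literature.Analysis.FluidPDE.curl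 v) x)))} ^ 2 * M ^ 2 * (∫ x, ‖curl v x‖ ^ 2))) hη hηc
    rw [← hd, h]
    ring
  -- du Bois-Reymond on the open set, then continuity
  have hGae : ∀ᵐ y ∂(volume : Measure (EuclideanSpace ℝ (Fin 3))), y ∈ {y | ‖v y‖ < M} →
      ((∫ x, ⟪curl v x, fderiv ℝ v x (curl v x)⟫) • (curl (curl (fun y => fderiv ℝ v y (curl v y))) y - curl (fun y => fderiv ℝ (curl v) y (curl v y)) y +
        curl (curl (fun y => ∑ j, ⟪curl v y, fderiv ℝ v y (EuclideanSpace.basisFun (Fin 3) ℝ j)⟫ •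
        EuclideanSpace.basisFun (Fin 3) ℝ j)) y) +
      (-(sInf {κ : ℝ | (∀ (v : EuclideanSpace ℝ (Fin 3) → EuclideanSpace ℝ (Fin 3)) (M B : ℝ), ContDiff ℝ (⊤ : ℕ∞) v → Literature.Analysis.FluidPDE.VectorCalculus.IsDivFree v → (∀ x, ‖v x‖ ≤ M) → (∀ x, ‖fderiv ℝ v x‖ ≤ B) → (∫⁻ x, ‖iteratedFDeriv ℝ 0 v x‖ₑ ^ 2 < ⊤) → (∫⁻ x, ‖iteratedFDeriv ℝ 1 v x‖ₑ ^ 2 < ⊤) → (∫⁻ x, ‖iteratedFDeriv ℝ 2 v x‖ₑ ^ 2 < ⊤) → |∫ x, ⟪Literature.Analysis.FluidPDE.curl v x, fderiv ℝ v x (Literature.Analysis.FluidPDE.curl v x)⟫_ℝ| ≤ κ * M * Real.sqrt (∫ x, ‖Literature.Analysis.FluidPDE.curl v x‖ ^ 2) * Real.sqrt (∫ x, Literature.Analysis.FluidPDE.frobeniusNormSq (fderiv ℝ (Literature.Analysis.FluidPDE.curl v) x)))} ^ 2 * M ^ 2 * (∫ x, frobeniusNormSq (fderiv ℝ (curl v)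 x)))) • curl (curl (curl v)) y - (-(sInf {κ : ℝ | (∀ (v : EuclideanSpace ℝ (Fin 3) → EuclideanSpace ℝ (Fin 3)) (M B : ℝ), ContDiff ℝ (⊤ : ℕ∞) v → Literature.Analysis.FluidPDE.VectorCalculus.IsDivFree v → (∀ x, ‖v x‖ ≤ M) → (∀ x, ‖fderiv ℝ v x‖ ≤ B) → (∫⁻ x, ‖iteratedFDeriv ℝ 0 v x‖ₑ ^ 2 < ⊤) → (∫⁻ x, ‖iteratedFDeriv ℝ 1 v x‖ₑ ^ 2 < ⊤) → (∫⁻ x, ‖iteratedFDeriv ℝ 2 v x‖ₑ ^ 2 < ⊤) → |∫ x, ⟪Literature.Analysis.FluidPDE.curl v x, fderiv ℝ v x (Literature.Analysis.FluidPDE.curl v x)⟫_ℝ| ≤ κ * M * Real.sqrt (∫ x, ‖Literature.Analysis.FluidPDE.curl v x‖ ^ 2) * Real.sqrt (∫ x, Literature.Analysis.FluidPDE.frobeniusNormSq (fderiv ℝ (Literature.Analysis.FluidPDE.curl v) x)))} ^ 2 * M ^ 2 * (∫ x, ‖curl v x‖ ^ 2))) • curl (curl (Δ (curl v))) y) = 0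 := by
    refine hUo.ae_eq_zero_of_integral_contDiff_smul_eq_zero (hGc.locallyIntegrable.locallyIntegrableOn _)
      fun θ hθ hθc hθU => ?_
    have hint : Integrable (fun y => θ y • ((∫ x, ⟪curl v x, fderiv ℝ v x (curl v x)⟫) • (curl (curl (fun y => fderiv ℝ v y (curl v y))) y - curl (fun y => fderiv ℝ (curl v) y (curl v y)) y +
        curl (curl (fun y => ∑ j, ⟪curl v y, fderiv ℝ v y (EuclideanSpace.basisFun (Fin 3) ℝ j)⟫ •
        EuclideanSpace.basisFun (Fin 3) ℝ j)) y) +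
      (-(sInf {κ : ℝ | (∀ (v : EuclideanSpace ℝ (Fin 3) → EuclideanSpace ℝ (Fin 3)) (M B : ℝ), ContDiff ℝ (⊤ : ℕ∞) v → Literature.Analysis.FluidPDE.VectorCalculus.IsDivFree v → (∀ x, ‖v x‖ ≤ M) → (∀ x, ‖fderiv ℝ v x‖ ≤ B) → (∫⁻ x, ‖iteratedFDeriv ℝ 0 v x‖ₑ ^ 2 < ⊤) → (∫⁻ x, ‖iteratedFDeriv ℝ 1 v x‖ₑ ^ 2 < ⊤) → (∫⁻ x, ‖iteratedFDeriv ℝ 2 v x‖ₑ ^ 2 < ⊤) → |∫ x, ⟪Literature.Analysis.FluidPDE.curl v x, fderiv ℝ v x (Literature.Analysis.FluidPDE.curl v x)⟫_ℝ| ≤ κ * M * Real.sqrt (∫ x, ‖Literature.Analysis.FluidPDE.curl v x‖ ^ 2) * Real.sqrt (∫ x, Literature.Analysis.FluidPDE.frobeniusNormSq (fderiv ℝ (Literature.Analysis.FluidPDE.curl v) x)))} ^ 2 * M ^ 2 * (∫ x, frobeniusNormSq (fderiv ℝ (curl v) x)))) • curl (curl (curl v)) y - (-(sInf {κ : ℝ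 | (∀ (v : EuclideanSpace ℝ (Fin 3) → EuclideanSpace ℝ (Fin 3)) (M B : ℝ), ContDiff ℝ (⊤ : ℕ∞) v → Literature.Analysis.FluidPDE.VectorCalculus.IsDivFree v → (∀ x, ‖v x‖ ≤ M) → (∀ x, ‖fderiv ℝ v x‖ ≤ B) → (∫⁻ x, ‖iteratedFDeriv ℝ 0 v x‖ₑ ^ 2 < ⊤) → (∫⁻ x, ‖iteratedFDeriv ℝ 1 v x‖ₑ ^ 2 < ⊤) → (∫⁻ x, ‖iteratedFDeriv ℝ 2 v x‖ₑ ^ 2 < ⊤) → |∫ x, ⟪Literature.Analysis.FluidPDE.curl v x, fderiv ℝ v x (Literature.Analysis.FluidPDE.curl v x)⟫_ℝ| ≤ κ * M * Real.sqrt (∫ x, ‖Literature.Analysis.FluidPDE.curl v x‖ ^ 2) * Real.sqrt (∫ x, Literature.Analysis.FluidPDE.frobeniusNormSq (fderiv ℝ (Literature.Analysis.FluidPDE.curl v) x)))} ^ 2 * M ^ 2 * (∫ x, ‖curl v x‖ ^ 2))) • curl (curl (Δ (curl v))) y))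
        (volume : Measure (EuclideanSpace ℝ (Fin 3))) :=
      (hθ.continuous.smul hGc).integrable_of_hasCompactSupport hθc.smul_right
    refine ext_inner_left ℝ fun e => ?_
    rw [inner_zero_right, ← integral_inner hint e]
    have hη : ContDiff ℝ ∞ fun y => θ y • e := hθ.smul contDiff_const
    have hηc : HasCompactSupport fun y => θ y • e := hθc.smul_right
    have hηU : tsupport (fun y => θ y • e) ⊆ {y | ‖v y‖ < M} := (tsupport_smul_subset_left _ _).trans hθU
    have hpt : ∀ y, ⟪e, θ y • ((∫ x, ⟪curl v x, fderiv ℝ v x (curl v x)⟫) • (curl (curl (fun y => fderiv ℝ v y (curl v y))) y - curl (fun y => fderiv ℝ (curl v) y (curl v y)) y +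
        curl (curl (fun y => ∑ j, ⟪curl v y, fderiv ℝ v y (EuclideanSpace.basisFun (Fin 3) ℝ j)⟫ •
        EuclideanSpace.basisFun (Fin 3) ℝ j)) y) +
      (-(sInf {κ : ℝ | (∀ (v : EuclideanSpace ℝ (Fin 3) → EuclideanSpace ℝ (Fin 3)) (M B : ℝ), ContDiff ℝ (⊤ : ℕ∞) v → Literature.Analysis.FluidPDE.VectorCalculus.IsDivFree v → (∀ x, ‖v x‖ ≤ M) → (∀ x, ‖fderiv ℝ v x‖ ≤ B) → (∫⁻ x, ‖iteratedFDeriv ℝ 0 v x‖ₑ ^ 2 < ⊤) → (∫⁻ x, ‖iteratedFDeriv ℝ 1 v x‖ₑ ^ 2 < ⊤) → (∫⁻ x, ‖iteratedFDeriv ℝ 2 v x‖ₑ ^ 2 < ⊤) → |∫ x, ⟪Literature.Analysis.FluidPDE.curl v x, fderiv ℝ v x (Literature.Analysis.FluidPDE.curl v x)⟫_ℝ| ≤ κ * M * Real.sqrt (∫ x, ‖Literature.Analysis.FluidPDE.curl v x‖ ^ 2) * Real.sqrt (∫ x, Literature.Analysis.FluidPDE.frobeniusNormSq (fderiv ℝ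 (Literature.Analysis.FluidPDE.curl v) x)))} ^ 2 * M ^ 2 * (∫ x, frobeniusNormSq (fderiv ℝ (curl v) x)))) • curl (curl (curl v)) y - (-(sInf {κ : ℝ | (∀ (v : EuclideanSpace ℝ (Fin 3) → EuclideanSpace ℝ (Fin 3)) (M B : ℝ), ContDiff ℝ (⊤ : ℕ∞) v → Literature.Analysis.FluidPDE.VectorCalculus.IsDivFree v → (∀ x, ‖v x‖ ≤ M) → (∀ x, ‖fderiv ℝ v x‖ ≤ B) → (∫⁻ x, ‖iteratedFDeriv ℝ 0 v x‖ₑ ^ 2 < ⊤) → (∫⁻ x, ‖iteratedFDeriv ℝ 1 v x‖ₑ ^ 2 < ⊤) → (∫⁻ x, ‖iteratedFDeriv ℝ 2 v x‖ₑ ^ 2 < ⊤) → |∫ x, ⟪Literature.Analysis.FluidPDE.curl v x, fderiv ℝ v x (Literature.Analysis.FluidPDE.curl v x)⟫_ℝ| ≤ κ * M * Real.sqrt (∫ x, ‖Literature.Analysis.FluidPDE.curl v x‖ ^ 2) * Real.sqrt (∫ x, Literature.Analysis.FluidPDE.frobeniusNormSq (fderiv ℝ (Literature.Analysis.FluidPDE.curl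 v) x)))} ^ 2 * M ^ 2 * (∫ x, ‖curl v x‖ ^ 2))) • curl (curl (Δ (curl v))) y)⟫ =
        ⟪((∫ x, ⟪curl v x, fderiv ℝ v x (curl v x)⟫) • (curl (curl (fun y => fderiv ℝ v y (curl v y))) y - curl (fun y => fderiv ℝ (curl v) y (curl v y)) y +
        curl (curl (fun y => ∑ j, ⟪curl v y, fderiv ℝ v y (EuclideanSpace.basisFun (Fin 3) ℝ j)⟫ •
        EuclideanSpace.basisFun (Fin 3) ℝ j)) y) +
      (-(sInf {κ : ℝ | (∀ (v : EuclideanSpace ℝ (Fin 3) → EuclideanSpace ℝ (Fin 3)) (M B : ℝ), ContDiff ℝ (⊤ : ℕ∞) v → Literature.Analysis.FluidPDE.VectorCalculus.IsDivFree v → (∀ x, ‖v x‖ ≤ M) → (∀ x, ‖fderiv ℝ v x‖ ≤ B) → (∫⁻ x, ‖iteratedFDeriv ℝ 0 v x‖ₑ ^ 2 < ⊤) → (∫⁻ x, ‖iteratedFDeriv ℝ 1 v x‖ₑ ^ 2 < ⊤) → (∫⁻ x, ‖iteratedFDeriv ℝ 2 v x‖ₑ ^ 2 < ⊤) → |∫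 x, ⟪Literature.Analysis.FluidPDE.curl v x, fderiv ℝ v x (Literature.Analysis.FluidPDE.curl v x)⟫_ℝ| ≤ κ * M * Real.sqrt (∫ x, ‖Literature.Analysis.FluidPDE.curl v x‖ ^ 2) * Real.sqrt (∫ x, Literature.Analysis.FluidPDE.frobeniusNormSq (fderiv ℝ (Literature.Analysis.FluidPDE.curl v) x)))} ^ 2 * M ^ 2 * (∫ x, frobeniusNormSq (fderiv ℝ (curl v) x)))) • curl (curl (curl v)) y - (-(sInf {κ : ℝ | (∀ (v : EuclideanSpace ℝ (Fin 3) → EuclideanSpace ℝ (Fin 3)) (M B : ℝ), ContDiff ℝ (⊤ : ℕ∞) v → Literature.Analysis.FluidPDE.VectorCalculus.IsDivFree v → (∀ x, ‖v x‖ ≤ M) → (∀ x, ‖fderiv ℝ v x‖ ≤ B) → (∫⁻ x, ‖iteratedFDeriv ℝ 0 v x‖ₑ ^ 2 < ⊤) → (∫⁻ x, ‖iteratedFDeriv ℝ 1 v x‖ₑ ^ 2 < ⊤) → (∫⁻ x, ‖iteratedFDeriv ℝ 2 v x‖ₑ ^ 2 < ⊤) → |∫ x, ⟪Literature.Analysis.FluidPDE.curl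 v x, fderiv ℝ v x (Literature.Analysis.FluidPDE.curl v x)⟫_ℝ| ≤ κ * M * Real.sqrt (∫ x, ‖Literature.Analysis.FluidPDE.curl v x‖ ^ 2) * Real.sqrt (∫ x, Literature.Analysis.FluidPDE.frobeniusNormSq (fderiv ℝ (Literature.Analysis.FluidPDE.curl v) x)))} ^ 2 * M ^ 2 * (∫ x, ‖curl v x‖ ^ 2))) • curl (curl (Δ (curl v))) y), θ y • e⟫ := fun y => by
      rw [inner_smul_right, inner_smul_right, real_inner_comm]
    rw [integral_congr_ae (Eventually.of_forall hpt)]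
    exact hℓ0 _ hη hηc hηU
  have hGU := Measure.eqOn_open_of_ae_eq ((ae_restrict_iff' hUo.measurableSet).2 hGae) hUo hGc.continuousOn
    continuousOn_const
  exact hGU hx

end DepletionLadder.KStar

end Summit.NavierStokesRegularity.NavierStokesRegularity.Theorems

end
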